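import Literature.NumberTheory.EllipticCurves.TwoTorsionOddDegreeBaseChangeProofs
import Summits.BirchSwinnertonDyer.BirchSwinnertonDyer.Theorems.KolyvaginRoadThreeClassCertificate
import Summits.BirchSwinnertonDyer.Rank1Residual.X11b.KolyvaginPointInertia
import Literature.NumberTheory.EllipticCurves.HeegnerPointsKolyvaginPrimaryUnramifiedProofs
import Literature.NumberTheory.EllipticCurves.HeegnerPointsKolyvaginClassesPointsProofs
import Literature.NumberTheory.EllipticCurves.SelmerLevelToPrimary
import HarnessLib

/-!
# Route `KolyvaginRankRigidityAtTwo`, crux V2♭ `KolyvaginCorankLowerBoundAtTwo`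
# (stmt-BirchSwinnertonDyer-24623), sub-rung (i) of `stub_posDepth`: the concrete Kolyvagin classes
# INTO the Selmer group — (i-a) level `2^M` classes into `H¹(K, E[2^∞])` with order preserved, and
# (i-b, good half) the Selmer local condition at every GOOD place `v ∤ n` and at infinity, for EVERY
# concrete datum and EVERY prime, unconditionally

Width prover `bsd-line-krr2-p2` (g5), re-tasked by the LEAD krr2-p1 g5 (bus 05:52Z: «take sub-rung (i)
… level-2^M Kolyvagin classes into Sel_{2^∞}(E/K)»); `--supports stmt-BirchSwinnertonDyer-24623 --as
helper`. THEOREMS ONLY (no definition, no named fact, no `sorry`); BSD is not proved by any of this;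
Kolyvagin's theorems at `2` are not asserted.

## What is proved

* §1 `smul_toGeomPoints_eq_self_of_mem_localInertia` — for `K` imaginary
  quadratic, a concrete datum `d` at level `n ≥ 1`, a finite place `v ∤ n`, a prime `𝔐` of the local
  absolute integers and `t` in its inertia group: `res(t)` FIXES every point of `E(K[n]) ⊆ E(K̄)`
  (`K[n]/K` is unramified at `v ∤ n`, Cox §9.A — x11b3's `KolyvaginH44.resGal_smul_algHom_ringClassField_eq_self`
  — and `Γ_K` acts on `E(K[n])` through the coordinates, `KolyCert.smul_toGeomPoints_of_forall_emb`).
* §1 `kolyvaginClass_mem_selmerLocalKer_of_hasGoodReductionAt` — **Gross 1991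
  Prop. 6.2 (1) ∕ McCallum 1991 Lemma 4.3 for the tree's CONCRETE class `c_M(n) = d.kolyvaginClass hp M`,
  ANY prime `p`, ANY `M`, at every finite place `v ∤ n` where `E/K` has GOOD reduction**:
  `c_M(n) ∈ selmerLocalKer (E/K) K_v p^M` — on the admissible branch by the tree's
  `kolyvaginClass_mem_selmerLocalKer_of_inertia` (Milne *ADT* I.3.8, `Milne2006_unramifiedClass_eq_zero_holds`),
  on the junk branch because the class is `0`. No Heegner hypothesis, no image hypothesis, no parity of `p`.
  `…_infinitePlace` — the (complex) infinite places impose no condition (`H¹(ℂ, ·) = 0`).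
* §2 (i-a) `torsionPowToPrimaryH1_two_injective_of_hasSurjectiveModNGaloisRep` — on the route's
  habitat (`ρ̄_{E,2}` onto, `K` quadratic) `E(K)[2] = 0` (`NoTwoTorsionOverK`), so krr2-p2 g0's
  `torsionPowToPrimaryH1 (E/K) 2 M : H¹(K, E[2^M]) → H¹(K, E[2^∞])` (p597646) is INJECTIVE
  (`torsionPowToPrimaryH1_injective_of_torsionBy_eq_bot`); hence `addOrderOf` is preserved and a
  non-zero `c_M(n)` stays non-zero in `H¹(K, E[2^∞])[2^M]`; Selmer classes go to `Sel_{2^∞}(E/K)`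
  (`map_torsionPowToPrimaryH1_selmerGroup_le`).

What is NOT here (the research content of `stub_posDepth` / V1′'s `stub_torsionLevelOne`, and the
bounded-defect half of (i-b)): the local condition at the BAD places `v ∣ N_E` (and `v ∣ 2` when `E` is
multiplicative at `2`) — there `c_M(n)` need not be Selmer at `2`; only `n′ • c_M(n)` is, `n′` killing
`E′/E⁰` ([GZ86 III (3.1)] via Gross p. 245, the cell's labelled input `hGZ31`; at `p = 2` the
coprimality `(n′, 2) = 1` used by x11b3/JET to divide `n′` out FAILS when a Tamagawa number is even) —
and the TRANSVERSE condition at the primes `ℓ ∣ n` (McCallum Prop. 4.4 / Kolyvagin's formula at 2).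

References (locators only): [cite: GrossLMS1991, §4 Lemma 4.3, (4.2), §6 Prop. 6.2 (1)]
[cite: McCallumLMS1991, §4 Lemma 4.3] [cite: MilneADT2006, Ch. I Prop. 3.8] [cite: Cox2013, §9.A]
[cite: WZhang2014, p. 248 (H¹(K,E[p^M]) ↪ H¹(K,E[p^{M+M′}]))] [cite: Greenberg1999, §2].
-/

set_option autoImplicit false
-- the Theorems namespace of this sub repeats the summit name by design (D-0017 nested layout)
set_option linter.dupNamespace false

noncomputable section

open scoped Classical

open WeierstrassCurve Field NumberField IsDedekindDomain
  Literature.NumberTheory.EllipticCurves Literature.NumberTheory.GaloisRepresentations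
  Literature.NumberTheory.EllipticCurves.ModularForms
  Literature.NumberTheory.EllipticCurves.KolyvaginCocycle
open Summit.BirchSwinnertonDyer.Rank1Residual.X11b
open Summit.BirchSwinnertonDyer.Rank1Residual.X11b.Three

namespace Summit.BirchSwinnertonDyer.BirchSwinnertonDyer.Theorems.KolyvaginRankRigidity

/-! ## §1 The concrete class is Selmer at the good places away from `n`, and at infinity -/

section Local

-- `K : Type`: the tree's ring-class class field theory is universe `0`.
variable {K : Type} [Field K] [NumberField K] {N : ℕ} [NeZero N] {W : WeierstrassCurve ℚ}
  {Dt : ModularParametrizationData W N} {β : ℤ} {ι : K →+* ℂ} {n : ℕ}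
  (d : KolyvaginHeegnerData Dt β ι n)

/-- **Local inertia away from `n` fixes `E(K[n]) ⊆ E(K̄)`** (McCallum 1991, Lemma 4.3 ∕ Gross 1991,
proof of Prop. 6.2 (1): *"`K_n/K` is unramified at `v ∤ n`"*): for `K` imaginary quadratic, a concrete
datum `d` at level `n ≥ 1`, a finite place `v` with `n ∉ v`, a prime `𝔐` of the local absolute
integers above `𝓂_v` and `t` in its inertia group, `res(t) • d.toGeomPoints P = d.toGeomPoints P` for
every `P ∈ E(K[n])`. (`res(t)` fixes `d.emb (K[n])` pointwise — Cox §9.A via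
`KolyvaginH44.resGal_smul_algHom_ringClassField_eq_self` — and acts on points coordinatewise.)
[cite: McCallumLMS1991, §4 Lemma 4.3] [cite: Cox2013, §9.A (p. 181)] -/
theorem smul_toGeomPoints_eq_self_of_mem_localInertia
    (hK : IsImaginaryQuadratic K) (hn : n ≠ 0) {v : HeightOneSpectrum (𝓞 K)}
    (hv : ((n : ℕ) : 𝓞 K) ∉ v.asIdeal) {𝔐 : Ideal (v.localAbsIntegers)}
    (h𝔐 : 𝔐 ∈ v.localPrimesAbove) {t : absoluteGaloisGroup (v.adicCompletion K)}
    (ht : t ∈ 𝔐.inertia (absoluteGaloisGroup (v.adicCompletion K)))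
    (P : (W.baseChange (ringClassField K ι n)).toAffine.Point) :
    resGal (K := K) (v.adicCompletion K) t • d.toGeomPoints P = d.toGeomPoints P := by
  -- `d.emb` as a `K`-algebra map `K[n] → K̄`
  let e : ringClassField K ι n →ₐ[K] AlgebraicClosure K :=
    { d.emb with commutes' := d.emb_apply }
  refine KolyCert.smul_toGeomPoints_of_forall_emb d _ (fun x ↦ ?_) P
  exact KolyvaginH44.resGal_smul_algHom_ringClassField_eq_self hK ι hn e hv h𝔐 ht x

/-- **Gross 1991, Prop. 6.2 (1) ∕ McCallum 1991, Lemma 4.3 for the CONCRETE class at a GOOD place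
`v ∤ n` — any prime `p`, any `M`, unconditionally.** For `K` imaginary quadratic, a Kolyvagin–Heegner
datum `d` at level `n ≥ 1` on a frame `(Dt, β, ι)` of the elliptic curve `W/ℚ`, a prime `p`, `M`, and a
finite place `v` of `K` with `n ∉ v` at which `E/K` has good reduction:
`c_M(n) = d.kolyvaginClass hp M ∈ selmerLocalKer (E/K) K_v p^M` (*"`c_M(n)_v ∈ δ(E(K_v))`"*). On the
admissible branch of the class this is the tree's `kolyvaginClass_mem_selmerLocalKer_of_inertia`
(inertia at `v` fixes `P(n)`, previous lemma; `H¹(K_v^{un}/K_v, E) = 0`, Milne *ADT* I.3.8 =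
`Milne2006_unramifiedClass_eq_zero_holds`); on the junk branch the class is `0`.
[cite: GrossLMS1991, §6 Prop. 6.2 (1)] [cite: McCallumLMS1991, §4 Lemma 4.3]
[cite: MilneADT2006, Ch. I Prop. 3.8] -/
theorem kolyvaginClass_mem_selmerLocalKer_of_hasGoodReductionAt [W.IsElliptic]
    (hK : IsImaginaryQuadratic K) (hn : n ≠ 0) {p : ℕ} (hp : p.Prime) (M : ℕ)
    (v : HeightOneSpectrum (𝓞 K)) (hv : ((n : ℕ) : 𝓞 K) ∉ v.asIdeal)
    (hgood : (W.baseChange K).HasGoodReductionAt v) :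
    d.kolyvaginClass hp M ∈ selmerLocalKer (W.baseChange K) (v.adicCompletion K) ((p ^ M : ℕ) : ℤ) := by
  haveI : (W.baseChange K).IsElliptic := by rw [baseChange]; infer_instance
  by_cases h : IsAdmissible (absoluteGaloisGroup K) d.pointsSubgroup ((p ^ M : ℕ) : ℤ) ∧
      d.toGeomPoints d.derivedPoint ∈
        invPoints (absoluteGaloisGroup K) d.pointsSubgroup ((p ^ M : ℕ) : ℤ)
  · rw [d.kolyvaginClass_of_admissible hp M h.1 h.2]
    obtain ⟨𝔐, h𝔐⟩ := v.localPrimesAbove_nonempty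
    exact kolyvaginClass_mem_selmerLocalKer_of_inertia (W.baseChange K) h.1 h.2 v hgood h𝔐
      fun t ht ↦ smul_toGeomPoints_eq_self_of_mem_localInertia d hK hn hv h𝔐 ht d.derivedPoint
  · rw [KolyvaginHeegnerData.kolyvaginClass, dif_neg h]
    exact AddSubgroup.zero_mem _

/-- **No condition at infinity**: `K` imaginary quadratic has only complex places, where
`H¹(ℂ, E) = 0`, so `c_M(n)` lies in every archimedean local kernel
(`mem_selmerLocalKer_infinitePlace_of_isImaginaryQuadratic`). [cite: GrossLMS1991, §6 (the places of K)] -/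
theorem kolyvaginClass_mem_selmerLocalKer_infinitePlace
    (hK : IsImaginaryQuadratic K) {p : ℕ} (hp : p.Prime) (M : ℕ) (w : InfinitePlace K) :
    d.kolyvaginClass hp M ∈ selmerLocalKer (W.baseChange K) w.Completion ((p ^ M : ℕ) : ℤ) :=
  mem_selmerLocalKer_infinitePlace_of_isImaginaryQuadratic hK _ w _

/-- **Selmer away from `n` and the bad places, packaged**: if every finite place `v ∤ n` at which
`E/K` has BAD reduction is separately known to satisfy the local condition (the bounded-defect ∕
`hGZ31` input, NOT supplied here) and so is every `v ∣ n` (the transverse input), then `c_M(n)` is a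
SELMER class: `c_M(n) ∈ Sel^{(p^M)}(E/K)`. Bookkeeping only (`mem_selmerGroup_iff`).
[cite: GrossLMS1991, §6 Prop. 6.2] [cite: McCallumLMS1991, §4 Lemma 4.3, Prop. 4.4] -/
theorem kolyvaginClass_mem_selmerGroup_of_bad_of_dvd [W.IsElliptic]
    (hK : IsImaginaryQuadratic K) (hn : n ≠ 0) {p : ℕ} (hp : p.Prime) (M : ℕ)
    (hbad : ∀ v : HeightOneSpectrum (𝓞 K), ((n : ℕ) : 𝓞 K) ∉ v.asIdeal →
      ¬ (W.baseChange K).HasGoodReductionAt v →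
      d.kolyvaginClass hp M ∈ selmerLocalKer (W.baseChange K) (v.adicCompletion K) ((p ^ M : ℕ) : ℤ))
    (hdvd : ∀ v : HeightOneSpectrum (𝓞 K), ((n : ℕ) : 𝓞 K) ∈ v.asIdeal →
      d.kolyvaginClass hp M ∈ selmerLocalKer (W.baseChange K) (v.adicCompletion K) ((p ^ M : ℕ) : ℤ)) :
    d.kolyvaginClass hp M ∈ selmerGroup (W.baseChange K) ((p ^ M : ℕ) : ℤ) := by
  rw [mem_selmerGroup_iff]
  refine ⟨fun v ↦ ?_, fun w ↦ kolyvaginClass_mem_selmerLocalKer_infinitePlace d hK hp M w⟩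
  by_cases hv : ((n : ℕ) : 𝓞 K) ∈ v.asIdeal
  · exact hdvd v hv
  by_cases hgood : (W.baseChange K).HasGoodReductionAt v
  · exact kolyvaginClass_mem_selmerLocalKer_of_hasGoodReductionAt d hK hn hp M v hv hgood
  · exact hbad v hv hgood

end Local

/-! ## §2 (i-a) Level `2^M` classes into `H¹(K, E[2^∞])`, order preserved, on the habitat -/

section Primary

variable {K : Type} [Field K] [NumberField K] (W : WeierstrassCurve ℚ) [W.IsElliptic]

/-- **`H¹(K, E[2^M]) ↪ H¹(K, E[2^∞])` on the route's habitat.** For `W/ℚ` elliptic with `ρ̄_{E,2}`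
onto and `K` a quadratic field, `E(K)[2] = 0` (Dokchitser–Dokchitser (1) + degree, the tree's
`torsionBy_two_baseChange_eq_bot_of_hasSurjectiveModNGaloisRep_two`; = the route's support `NoTwoTorsionOverK`), so the level-raising map `torsionPowToPrimaryH1 (E/K) 2 M`
(krr2-p2 g0, `SelmerLevelToPrimary`) is injective (W. Zhang 2014 p. 248:
`H¹(K, E[p^M]) ↪ H¹(K, E[p^{M+M′}])` under irreducibility). [cite: WZhang2014, p. 248]
[cite: GrossLMS1991, §4 (proof of Prop. 4.1)] -/
theorem torsionPowToPrimaryH1_two_injective_of_hasSurjectiveModNGaloisRep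
    (hK : Module.finrank ℚ K = 2) (hs : W.HasSurjectiveModNGaloisRep 2) (M : ℕ) :
    Function.Injective (torsionPowToPrimaryH1 (W.baseChange K) 2 M) := by
  haveI : PerfectField K := PerfectField.ofCharZero
  have h3 : ¬ 3 ∣ Module.finrank ℚ K := by rw [hK]; decide
  have htor : AddSubgroup.torsionBy (W.baseChange K).toAffine.Point (2 : ℤ) = ⊥ :=
    torsionBy_two_baseChange_eq_bot_of_hasSurjectiveModNGaloisRep_two W hs K h3
  exact torsionPowToPrimaryH1_injective_of_torsionBy_eq_bot (W.baseChange K) 2 M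
    (by exact_mod_cast htor)

/-- **Order preserved**: on the habitat, the image of a level-`2^M` class in `H¹(K, E[2^∞])` has the
same (additive) order; in particular a non-zero Kolyvagin class `c_M(n) ≠ 0` stays non-zero in
`H¹(K, E[2^∞])[2^M]` (the currency of `Sel_{2^∞}(E/K)` and of the `ℤ₂`-corank statements of V2♭).
[cite: WZhang2014, p. 248] -/
theorem addOrderOf_torsionPowToPrimaryH1_two_eq (hK : Module.finrank ℚ K = 2)
    (hs : W.HasSurjectiveModNGaloisRep 2) (M : ℕ)
    (c : galH1Torsion (W.baseChange K) ((2 ^ M : ℕ) : ℤ)) :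
    addOrderOf (torsionPowToPrimaryH1 (W.baseChange K) 2 M c) = addOrderOf c :=
  addOrderOf_injective _ (torsionPowToPrimaryH1_two_injective_of_hasSurjectiveModNGaloisRep W hK hs M) c

/-- A non-zero level-`2^M` class is non-zero in `H¹(K, E[2^∞])`, on the habitat. [cite: WZhang2014, p. 248] -/
theorem torsionPowToPrimaryH1_two_ne_zero (hK : Module.finrank ℚ K = 2)
    (hs : W.HasSurjectiveModNGaloisRep 2) (M : ℕ)
    {c : galH1Torsion (W.baseChange K) ((2 ^ M : ℕ) : ℤ)} (hc : c ≠ 0) :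
    torsionPowToPrimaryH1 (W.baseChange K) 2 M c ≠ 0 := fun h ↦
  hc ((torsionPowToPrimaryH1_two_injective_of_hasSurjectiveModNGaloisRep W hK hs M)
    (h.trans (map_zero _).symm))

omit [W.IsElliptic] in
/-- **Selmer classes of level `2^M` land in `Sel_{2^∞}(E/K)`** (any `E/K`; `Greenberg 1999 §2`):
the tree's `map_torsionPowToPrimaryH1_selmerGroup_le`, element form. [cite: Greenberg1999, §2 (p. 63)] -/
theorem torsionPowToPrimaryH1_mem_selmerGroupPInfty_of_mem (p M : ℕ)
    {c : galH1Torsion (W.baseChange K) ((p ^ M : ℕ) : ℤ)}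
    (hc : c ∈ selmerGroup (W.baseChange K) ((p ^ M : ℕ) : ℤ)) :
    torsionPowToPrimaryH1 (W.baseChange K) p M c ∈ selmerGroupPInfty (W.baseChange K) p :=
  map_torsionPowToPrimaryH1_selmerGroup_le (W.baseChange K) p M ⟨c, hc, rfl⟩

end Primary

end Summit.BirchSwinnertonDyer.BirchSwinnertonDyer.Theorems.KolyvaginRankRigidity

end
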